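import Summits.QuantumFields.QCD.Theorems.WilsonMobilityGapMobilityGapSketchDeepWindow

/-!
# Crux `MobilityGap` (stmt-QuantumFields-9150) — line `Sketch`, reshape 5: the three-flavour sign stub as a
# DEEP + WINDOW law (composition of skeleton v6 and its monotonicity)

Lead seat prover-line-stmt-QuantumFields-9150-c4-0 (cycle 5 of the line), helper file `--supports stmt-QuantumFields-9150`.

With the landed `sign_of_deepWindow_three` (`…SketchDeepWindow.lean`: for three flavours a negative Wilson weight forces a
real eigenvalue of `D_W(U,0,1)` either below ALL three bare masses (DEEP) or strictly between two of them (WINDOW)), the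
`N_f = 3` sign stub of the line can be asked with the refined integrand
`#{z : Im z = 0, ∀ f, Re z < −t_f} + #{z : Im z = 0, (∃ f, Re z < −t_f) ∧ ∃ g, −t_g < Re z}` instead of
`Σ_f #{z : Im z = 0, Re z < −t_f}`.  §1 the refined count is pointwise SMALLER (the two summands are disjoint sets of
roots, each counted at least once in the flavour sum), §2 hence so are the phase-quenched expectations on every torus
(skeleton v6 is a weakening of v5: `deepWindowLaw_of_extinctLaw_three`), §3 the glue `signAt_of_deepWindowAt` along a
free three-flavour datum and the composition `MobilityGap_of_freeLaws_deepWindow` of skeleton v6 (stubs `stub_lightFree`,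
`stub_lowerAt`, `stub_windowAt` for `N_f = 2`, `stub_deepWindowAt` for `N_f = 3`).  The odd-flavour obstruction of the
route (deep crossers below every bare mass, barrier `WilsonDeterminantSign`) and the mass-splitting obstruction (real modes
between two bare masses, barrier `WilsonDeterminantMassSplitting`) are thereby separated inside one stub.
-/

noncomputable section

namespace Summit.QuantumFields.QCD.Theorems.MobilityGapSketch

open scoped BigOperators Topology
open MeasureTheory Filter Set
open Literature.MathematicalPhysics.QuantumFieldTheory Literature.MathematicalPhysics.QuantumLattice
  Literature.Probability.LatticeModels

/-! ### §1 Pointwise: deep + window count ≤ flavour-summed deep-crosser count -/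

/-- **Deep + window ≤ three-flavour deep-crosser count** (multisets).  For every multiset `s` of complex numbers and
every triple `t : Fin 3 → ℝ`: `#{z ∈ s : Im z = 0, ∀ f, Re z < −t_f} + #{z ∈ s : Im z = 0, (∃ f, Re z < −t_f) ∧ ∃ g, −t_g < Re z}`
`≤ Σ_f #{z ∈ s : Im z = 0, Re z < −t_f}`.  The two predicates are disjoint, so the left side counts the elements satisfying
one of them; each such element has `Re z < −t_{f₀}` for the index `f₀` of the least mass, and the other two summands are
non-negative. [folklore] -/
theorem countP_deep_add_countP_spread_le_sum (s : Multiset ℂ) (t : Fin 3 → ℝ) :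
    s.countP (fun z : ℂ => z.im = 0 ∧ ∀ f, z.re < -t f) +
        s.countP (fun z : ℂ => z.im = 0 ∧ (∃ f, z.re < -t f) ∧ ∃ g, -t g < z.re) ≤
      ∑ f : Fin 3, s.countP (fun z : ℂ => z.im = 0 ∧ z.re < -t f) := by
  classical
  obtain ⟨f₀, hf₀⟩ := Finite.exists_min t
  -- disjointness: the union count is the sum of the two counts
  have hdisj : ∀ z : ℂ, ¬ ((z.im = 0 ∧ ∀ f, z.re < -t f) ∧ (z.im = 0 ∧ (∃ f, z.re < -t f) ∧ ∃ g, -t g < z.re)) := by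
    rintro z ⟨⟨-, hall⟩, -, -, g, hg⟩
    exact absurd (hall g) (not_lt.2 hg.le)
  have hsum : s.countP (fun z : ℂ => z.im = 0 ∧ ∀ f, z.re < -t f) +
      s.countP (fun z : ℂ => z.im = 0 ∧ (∃ f, z.re < -t f) ∧ ∃ g, -t g < z.re) =
      s.countP (fun z : ℂ => (z.im = 0 ∧ ∀ f, z.re < -t f) ∨ (z.im = 0 ∧ (∃ f, z.re < -t f) ∧ ∃ g, -t g < z.re)) := by
    rw [Multiset.countP_eq_card_filter, Multiset.countP_eq_card_filter, Multiset.countP_eq_card_filter,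
      ← Multiset.card_add, Multiset.filter_add_filter]
    have h0 : Multiset.filter (fun z : ℂ => (z.im = 0 ∧ ∀ f, z.re < -t f) ∧
        (z.im = 0 ∧ (∃ f, z.re < -t f) ∧ ∃ g, -t g < z.re)) s = 0 :=
      Multiset.filter_eq_nil.2 fun z _ => hdisj z
    rw [h0, add_zero]
  rw [hsum]
  -- the union is below the lightest threshold
  have hle : s.countP (fun z : ℂ => (z.im = 0 ∧ ∀ f, z.re < -t f) ∨
      (z.im = 0 ∧ (∃ f, z.re < -t f) ∧ ∃ g, -t g < z.re)) ≤
      s.countP (fun z : ℂ => z.im = 0 ∧ z.re < -t f₀) := by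
    rw [Multiset.countP_eq_card_filter, Multiset.countP_eq_card_filter]
    refine Multiset.card_le_card (Multiset.monotone_filter_right _ fun z hz => ?_)
    rcases hz with ⟨him, hall⟩ | ⟨him, ⟨f, hf⟩, -⟩
    · exact ⟨him, hall f₀⟩
    · exact ⟨him, hf.trans_le (neg_le_neg (hf₀ f))⟩
  refine hle.trans ?_
  exact Finset.single_le_sum (f := fun f => s.countP (fun z : ℂ => z.im = 0 ∧ z.re < -t f))
    (fun f _ => Nat.zero_le _) (Finset.mem_univ f₀)

/-! ### §2 The integrated inequality on a fixed torus -/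

variable {N : ℕ} [NeZero N]

/-- **Expected deep + window count ≤ expected three-flavour deep-crosser count.**  For every torus side, coupling `β`
and bare triple `t`, the phase-quenched expectation (quotient of Wilson-measure integrals with the weight
`∏_f |det D_W(U,t_f,1)|`) of the refined count is at most that of `Σ_f #{real eigenvalues of D_W(U,0,1) below −t_f}`.
(Integrate §1 against the non-negative weight — the counts are measurable (`measurable_countP_charpoly_roots_deep`,
`measurable_countP_charpoly_roots_spread`, `measurable_countP_charpoly_roots_real_lt`) and bounded, the weight is
integrable — and divide by the common non-negative normalisation.) -/
theorem deepWindowQuotient_le_extinctQuotient_three (β : ℝ) (t : Fin 3 → ℝ) :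
    (∫ U : GaugeConfig 4 N (Matrix.specialUnitaryGroup (Fin 3) ℂ),
        (((wilsonDirac (fundamentalRep (Fin 3)) U 0 1).charpoly.roots.countP
            (fun z : ℂ => z.im = 0 ∧ ∀ f, z.re < -t f) : ℝ) +
          ((wilsonDirac (fundamentalRep (Fin 3)) U 0 1).charpoly.roots.countP
            (fun z : ℂ => z.im = 0 ∧ (∃ f, z.re < -t f) ∧ ∃ g, -t g < z.re) : ℝ)) *
          ∏ f : Fin 3, ‖fermionDet (wilsonDirac (fundamentalRep (Fin 3)) U (t f) 1)‖
        ∂(wilsonMeasure (d := 4) (L := N) (fundamentalRep (Fin 3)) β)) /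
      (∫ U : GaugeConfig 4 N (Matrix.specialUnitaryGroup (Fin 3) ℂ),
        ∏ f : Fin 3, ‖fermionDet (wilsonDirac (fundamentalRep (Fin 3)) U (t f) 1)‖
        ∂(wilsonMeasure (d := 4) (L := N) (fundamentalRep (Fin 3)) β)) ≤
    (∫ U : GaugeConfig 4 N (Matrix.specialUnitaryGroup (Fin 3) ℂ),
        (∑ f : Fin 3, (Multiset.countP (fun z : ℂ => z.im = 0 ∧ z.re < -t f)
          (wilsonDirac (fundamentalRep (Fin 3)) U 0 1).charpoly.roots : ℝ)) *
          ∏ f : Fin 3, ‖fermionDet (wilsonDirac (fundamentalRep (Fin 3)) U (t f) 1)‖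
        ∂(wilsonMeasure (d := 4) (L := N) (fundamentalRep (Fin 3)) β)) /
      (∫ U : GaugeConfig 4 N (Matrix.specialUnitaryGroup (Fin 3) ℂ),
        ∏ f : Fin 3, ‖fermionDet (wilsonDirac (fundamentalRep (Fin 3)) U (t f) 1)‖
        ∂(wilsonMeasure (d := 4) (L := N) (fundamentalRep (Fin 3)) β)) := by
  classical
  set μ := wilsonMeasure (d := 4) (L := N) (fundamentalRep (Fin 3)) β with hμ
  set A : GaugeConfig 4 N (Matrix.specialUnitaryGroup (Fin 3) ℂ) → ℝ := fun U =>
    ∏ f : Fin 3, ‖fermionDet (wilsonDirac (fundamentalRep (Fin 3)) U (t f) 1)‖ with hA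
  set W : GaugeConfig 4 N (Matrix.specialUnitaryGroup (Fin 3) ℂ) → ℝ := fun U =>
    (((wilsonDirac (fundamentalRep (Fin 3)) U 0 1).charpoly.roots.countP
        (fun z : ℂ => z.im = 0 ∧ ∀ f, z.re < -t f) : ℝ) +
      ((wilsonDirac (fundamentalRep (Fin 3)) U 0 1).charpoly.roots.countP
        (fun z : ℂ => z.im = 0 ∧ (∃ f, z.re < -t f) ∧ ∃ g, -t g < z.re) : ℝ)) with hW
  set E : GaugeConfig 4 N (Matrix.specialUnitaryGroup (Fin 3) ℂ) → ℝ := fun U =>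
    ∑ f : Fin 3, ((wilsonDirac (fundamentalRep (Fin 3)) U 0 1).charpoly.roots.countP
      (fun z : ℂ => z.im = 0 ∧ z.re < -t f) : ℝ) with hE
  change (∫ U, W U * A U ∂μ) / (∫ U, A U ∂μ) ≤ (∫ U, E U * A U ∂μ) / (∫ U, A U ∂μ)
  have hAeq : A = fun U => ‖(diracMatrix U t).det‖ := funext fun U => (norm_det_diracMatrix U t).symm
  -- the weight: non-negative and integrable
  have hAi : Integrable A μ := by rw [hAeq]; exact integrable_norm_det_diracMatrix t μ
  have hA0 : ∀ U, 0 ≤ A U := fun U => Finset.prod_nonneg fun f _ => norm_nonneg _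
  have hZ0 : 0 ≤ ∫ U, A U ∂μ := integral_nonneg hA0
  -- the two integrands: measurable, non-negative, ordered, bounded
  have hWm : Measurable W := by
    refine Measurable.add ?_ ?_
    · exact (measurable_from_nat (f := (Nat.cast : ℕ → ℝ))).comp
        (measurable_countP_charpoly_roots_deep
          (continuous_wilsonDirac (fundamentalRep (Fin 3)) (continuous_fundamentalRep (Fin 3)) 0 1) t)
    · exact (measurable_from_nat (f := (Nat.cast : ℕ → ℝ))).comp
        (measurable_countP_charpoly_roots_spread
          (continuous_wilsonDirac (fundamentalRep (Fin 3)) (continuous_fundamentalRep (Fin 3)) 0 1) t)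
  have hEm : Measurable E := by
    refine Finset.measurable_sum _ fun f _ => ?_
    exact (measurable_from_nat (f := (Nat.cast : ℕ → ℝ))).comp
      (PositivityDeficitLeDefects.measurable_countP_charpoly_roots_real_lt
        (continuous_wilsonDirac (fundamentalRep (Fin 3)) (continuous_fundamentalRep (Fin 3)) 0 1) (-t f))
  have hW0 : ∀ U, 0 ≤ W U := fun U => add_nonneg (Nat.cast_nonneg _) (Nat.cast_nonneg _)
  have hE0 : ∀ U, 0 ≤ E U := fun U => Finset.sum_nonneg fun f _ => Nat.cast_nonneg _
  have hWE : ∀ U, W U ≤ E U := fun U => by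
    simp only [hW, hE]
    exact_mod_cast countP_deep_add_countP_spread_le_sum
      (wilsonDirac (fundamentalRep (Fin 3)) U 0 1).charpoly.roots t
  have hle : ∀ (U : GaugeConfig 4 N (Matrix.specialUnitaryGroup (Fin 3) ℂ)) (f : Fin 3),
      ((wilsonDirac (fundamentalRep (Fin 3)) U 0 1).charpoly.roots.countP
        (fun z : ℂ => z.im = 0 ∧ z.re < -t f) : ℝ) ≤ Fintype.card (TorusSite 4 N × Fin 3 × Fin 4) := by
    intro U f
    have h1 := Multiset.countP_le_card (fun z : ℂ => z.im = 0 ∧ z.re < -t f)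
      (wilsonDirac (fundamentalRep (Fin 3)) U 0 1).charpoly.roots
    have h2 := Polynomial.card_roots' (wilsonDirac (fundamentalRep (Fin 3)) U 0 1).charpoly
    rw [Matrix.charpoly_natDegree_eq_dim] at h2
    exact_mod_cast h1.trans h2
  have hEle : ∀ U, E U ≤ 3 * Fintype.card (TorusSite 4 N × Fin 3 × Fin 4) := by
    intro U
    simp only [hE, Fin.sum_univ_three]
    linarith [hle U 0, hle U 1, hle U 2]
  -- integrability of the two integrands
  have hEAi : Integrable (fun U => E U * A U) μ := by
    refine (hAi.const_mul (3 * Fintype.card (TorusSite 4 N × Fin 3 × Fin 4))).mono'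
      (hEm.aestronglyMeasurable.mul hAi.aestronglyMeasurable) (Eventually.of_forall fun U => ?_)
    rw [Real.norm_eq_abs, abs_of_nonneg (mul_nonneg (hE0 U) (hA0 U))]
    exact mul_le_mul_of_nonneg_right (hEle U) (hA0 U)
  have hWAi : Integrable (fun U => W U * A U) μ := by
    refine hEAi.mono' (hWm.aestronglyMeasurable.mul hAi.aestronglyMeasurable)
      (Eventually.of_forall fun U => ?_)
    rw [Real.norm_eq_abs, abs_of_nonneg (mul_nonneg (hW0 U) (hA0 U))]
    exact mul_le_mul_of_nonneg_right (hWE U) (hA0 U)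
  -- integrate the pointwise bound and divide by the common normalisation
  have hint : ∫ U, W U * A U ∂μ ≤ ∫ U, E U * A U ∂μ :=
    integral_mono hWAi hEAi fun U => mul_le_mul_of_nonneg_right (hWE U) (hA0 U)
  exact div_le_div_of_nonneg_right hint hZ0

/-! ### §3 The deep + window law along a free datum: monotonicity, glue, composition of skeleton v6 -/

/-- **Skeleton v6 is a weakening of v5 on the three-flavour sign side**: if every admissible three-flavour datum
carrying a light moment satisfies the deep-crosser extinction law `ExtinctAt d`, then every such datum satisfies the
DEEP + WINDOW law (same admissible volume sequence, same `δ`/`M`/`k`/`t` shell; `deepWindowQuotient_le_extinctQuotient_three`). -/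
theorem deepWindowLaw_of_extinctLaw_three :
    (∀ d : LineData 3, LightMomentAt 3 d.a d.β d.s → ExtinctAt d) →
    ∀ d : LineData 3, LightMomentAt 3 d.a d.β d.s →
      ∃ L : ℕ → ℕ, Tendsto (fun k => d.a k * (L k : ℝ)) atTop atTop ∧ (∀ᶠ k in atTop, d.vfloor k ≤ L k) ∧
        ∀ᶠ δ in atTop, ∀ M : ℝ, 0 < M → ∀ᶠ k in atTop,
          (floorSetD d δ k).Nonempty → -1 < thrD d δ k → ∀ t : Fin 3 → ℝ,
            (∀ f, thrD d δ k < t f) → (∀ f, t f ≤ thrD d δ k + d.a k * M / d.zm k) →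
              (∫ U : GaugeConfig 4 (2 * L k + 1) (Matrix.specialUnitaryGroup (Fin 3) ℂ),
                  (((wilsonDirac (fundamentalRep (Fin 3)) U 0 1).charpoly.roots.countP
                      (fun z : ℂ => z.im = 0 ∧ ∀ f, z.re < -t f) : ℝ) +
                    ((wilsonDirac (fundamentalRep (Fin 3)) U 0 1).charpoly.roots.countP
                      (fun z : ℂ => z.im = 0 ∧ (∃ f, z.re < -t f) ∧ ∃ g, -t g < z.re) : ℝ)) *
                    ∏ f : Fin 3, ‖fermionDet (wilsonDirac (fundamentalRep (Fin 3)) U (t f) 1)‖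
                  ∂(wilsonMeasure (d := 4) (L := 2 * L k + 1) (fundamentalRep (Fin 3)) (d.β k))) /
                (∫ U : GaugeConfig 4 (2 * L k + 1) (Matrix.specialUnitaryGroup (Fin 3) ℂ),
                  ∏ f : Fin 3, ‖fermionDet (wilsonDirac (fundamentalRep (Fin 3)) U (t f) 1)‖
                  ∂(wilsonMeasure (d := 4) (L := 2 * L k + 1) (fundamentalRep (Fin 3)) (d.β k))) ≤ 1 / 4 := by
  intro hExt d hd
  obtain ⟨L, hL, hfl, hδ⟩ := hExt d hd
  refine ⟨L, hL, hfl, hδ.mono fun δ hδ' M hM => (hδ' M hM).mono fun k hk hne hthr t ht₁ ht₂ => ?_⟩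
  exact (deepWindowQuotient_le_extinctQuotient_three (d.β k) t).trans (hk hne hthr t ht₁ ht₂)

/-- **`DeepWindowAt`-glue**: along an admissible three-flavour datum `d`, the DEEP + WINDOW law (the statement of the
registered stub `stub_deepWindowAt` of skeleton v6, unfolded) implies the sign law `SignAt d`
(`sign_of_deepWindow_three` triple by triple). -/
theorem signAt_of_deepWindowAt {d : LineData 3}
    (h : ∃ L : ℕ → ℕ, Tendsto (fun k => d.a k * (L k : ℝ)) atTop atTop ∧ (∀ᶠ k in atTop, d.vfloor k ≤ L k) ∧
      ∀ᶠ δ in atTop, ∀ M : ℝ, 0 < M → ∀ᶠ k in atTop,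
        (floorSetD d δ k).Nonempty → -1 < thrD d δ k → ∀ t : Fin 3 → ℝ,
          (∀ f, thrD d δ k < t f) → (∀ f, t f ≤ thrD d δ k + d.a k * M / d.zm k) →
            (∫ U : GaugeConfig 4 (2 * L k + 1) (Matrix.specialUnitaryGroup (Fin 3) ℂ),
                (((wilsonDirac (fundamentalRep (Fin 3)) U 0 1).charpoly.roots.countP
                    (fun z : ℂ => z.im = 0 ∧ ∀ f, z.re < -t f) : ℝ) +
                  ((wilsonDirac (fundamentalRep (Fin 3)) U 0 1).charpoly.roots.countP
                    (fun z : ℂ => z.im = 0 ∧ (∃ f, z.re < -t f) ∧ ∃ g, -t g < z.re) : ℝ)) *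
                  ∏ f : Fin 3, ‖fermionDet (wilsonDirac (fundamentalRep (Fin 3)) U (t f) 1)‖
                ∂(wilsonMeasure (d := 4) (L := 2 * L k + 1) (fundamentalRep (Fin 3)) (d.β k))) /
              (∫ U : GaugeConfig 4 (2 * L k + 1) (Matrix.specialUnitaryGroup (Fin 3) ℂ),
                ∏ f : Fin 3, ‖fermionDet (wilsonDirac (fundamentalRep (Fin 3)) U (t f) 1)‖
                ∂(wilsonMeasure (d := 4) (L := 2 * L k + 1) (fundamentalRep (Fin 3)) (d.β k))) ≤ 1 / 4) :
    SignAt d := by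
  obtain ⟨L, hL, hfl, hδ⟩ := h
  refine ⟨L, hL, hfl, hδ.mono fun δ hd M hM => (hd M hM).mono fun k hk hne hthr t ht₁ ht₂ => ?_⟩
  exact sign_of_deepWindow_three (2 * L k + 1) (d.β k) t (hk hne hthr t ht₁ ht₂)

/-- **The crux from the four laws of skeleton v6** (`stub_lightFree`, `stub_lowerAt`, `stub_windowAt` for `N_f = 2`,
`stub_deepWindowAt` for `N_f = 3`): pack the datum of the free light moment and run the threshold line along it
(`compositionD`), feeding the sign law from the WINDOW law at `N_f = 2` (`signAt_of_windowAt`) and from the DEEP + WINDOW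
law at `N_f = 3` (`signAt_of_deepWindowAt`). -/
theorem MobilityGap_of_freeLaws_deepWindow :
    LawLightFree → LawLowerFree →
    (∀ d : LineData 2, LightMomentAt 2 d.a d.β d.s →
      ∃ L : ℕ → ℕ, Tendsto (fun k => d.a k * (L k : ℝ)) atTop atTop ∧ (∀ᶠ k in atTop, d.vfloor k ≤ L k) ∧
        ∀ᶠ δ in atTop, ∀ M : ℝ, 0 < M → ∀ᶠ k in atTop,
          (floorSetD d δ k).Nonempty → -1 < thrD d δ k → ∀ t : Fin 2 → ℝ,
            (∀ f, thrD d δ k < t f) → (∀ f, t f ≤ thrD d δ k + d.a k * M / d.zm k) →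
              (∫ U : GaugeConfig 4 (2 * L k + 1) (Matrix.specialUnitaryGroup (Fin 3) ℂ),
                  ((wilsonDirac (fundamentalRep (Fin 3)) U 0 1).charpoly.roots.countP
                      (fun z : ℂ => z.im = 0 ∧ -max (t 0) (t 1) < z.re ∧ z.re < -min (t 0) (t 1)) : ℝ) *
                    ∏ f : Fin 2, ‖fermionDet (wilsonDirac (fundamentalRep (Fin 3)) U (t f) 1)‖
                  ∂(wilsonMeasure (d := 4) (L := 2 * L k + 1) (fundamentalRep (Fin 3)) (d.β k))) /
                (∫ U : GaugeConfig 4 (2 * L k + 1) (Matrix.specialUnitaryGroup (Fin 3) ℂ),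
                  ∏ f : Fin 2, ‖fermionDet (wilsonDirac (fundamentalRep (Fin 3)) U (t f) 1)‖
                  ∂(wilsonMeasure (d := 4) (L := 2 * L k + 1) (fundamentalRep (Fin 3)) (d.β k))) ≤ 1 / 4) →
    (∀ d : LineData 3, LightMomentAt 3 d.a d.β d.s →
      ∃ L : ℕ → ℕ, Tendsto (fun k => d.a k * (L k : ℝ)) atTop atTop ∧ (∀ᶠ k in atTop, d.vfloor k ≤ L k) ∧
        ∀ᶠ δ in atTop, ∀ M : ℝ, 0 < M → ∀ᶠ k in atTop,
          (floorSetD d δ k).Nonempty → -1 < thrD d δ k → ∀ t : Fin 3 → ℝ,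
            (∀ f, thrD d δ k < t f) → (∀ f, t f ≤ thrD d δ k + d.a k * M / d.zm k) →
              (∫ U : GaugeConfig 4 (2 * L k + 1) (Matrix.specialUnitaryGroup (Fin 3) ℂ),
                  (((wilsonDirac (fundamentalRep (Fin 3)) U 0 1).charpoly.roots.countP
                      (fun z : ℂ => z.im = 0 ∧ ∀ f, z.re < -t f) : ℝ) +
                    ((wilsonDirac (fundamentalRep (Fin 3)) U 0 1).charpoly.roots.countP
                      (fun z : ℂ => z.im = 0 ∧ (∃ f, z.re < -t f) ∧ ∃ g, -t g < z.re) : ℝ)) *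
                    ∏ f : Fin 3, ‖fermionDet (wilsonDirac (fundamentalRep (Fin 3)) U (t f) 1)‖
                  ∂(wilsonMeasure (d := 4) (L := 2 * L k + 1) (fundamentalRep (Fin 3)) (d.β k))) /
                (∫ U : GaugeConfig 4 (2 * L k + 1) (Matrix.specialUnitaryGroup (Fin 3) ℂ),
                  ∏ f : Fin 3, ‖fermionDet (wilsonDirac (fundamentalRep (Fin 3)) U (t f) 1)‖
                  ∂(wilsonMeasure (d := 4) (L := 2 * L k + 1) (fundamentalRep (Fin 3)) (d.β k))) ≤ 1 / 4) →
    Summit.QuantumFields.QCD.Theses.WilsonMobilityGap.MobilityGap := by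
  intro h₁ h₂ h₃ h₄ Nf hNf
  rcases hNf with rfl | rfl
  · obtain ⟨d, hd⟩ := exists_lineData_of_lightMomentFree (h₁ 2 (Or.inl rfl))
    exact compositionD d (badFloorAt_of_lightMomentAt hd) (h₂ 2 (Or.inl rfl) d hd) (signAt_of_windowAt (h₃ d hd))
  · obtain ⟨d, hd⟩ := exists_lineData_of_lightMomentFree (h₁ 3 (Or.inr rfl))
    exact compositionD d (badFloorAt_of_lightMomentAt hd) (h₂ 3 (Or.inr rfl) d hd)
      (signAt_of_deepWindowAt (h₄ d hd))

end Summit.QuantumFields.QCD.Theorems.MobilityGapSketch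

end
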